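import Summits.QuantumFields.YangMills.Theorems.TwistedTraceScaling.Negative.TowerE1FalseWithoutBetaGuardsOfBase
import Literature.MathematicalPhysics.QuantumFieldTheory.Balaban1983to89.T4TwoLoopLaw
import Literature.MathematicalPhysics.QuantumFieldTheory.Balaban1983to89.FlowStepRuns
import Literature.MathematicalPhysics.QuantumFieldTheory.Balaban1983to89.B12Normalization
import HarnessLib

/-!
# `TwistedTraceScaling` (crux stmt-QuantumFields-20203, route `LuscherReduction`, skeleton «twolattice» REV 3 «TWO-LOOP CALIBRATION»,
# sha16 1a2ae9b1ae61a9c5): negative-side support VI — the coupling guards and the quantifier order `∀ φ ∃ lam` of the two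
# new stubs TRACK (`stub_labelTracking`) and CMP-2LOOP (`stub_cmpTwoLoop`)
# (refuter crux-disprover seat, cycle 4; this file does NOT refute the crux or any registered stub)

HONEST FRAMING: `TwistedTraceScaling` is a femto-rung (R2b1) crux of a CONDITIONAL reduction route; nothing here is a mass-gap or Clay
statement.  Rev 3 of the line re-types the XL comparison on CALIBRATED data: a flow family `φ : FlowStep.HBeta` obeying a two-loop law
`Stmt.twoLoopLawH binf b1inf φ` (hypothesis SHAPE), the CALIBRATOR `x̂ = flowInvSq φ β (k+1) = 1 / genSeq φ (bareBal β) (k+1) ²` (inverse coupling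
flowed `k+1` block steps from the Bałaban-unit bare value `bareBal β = 1/√(2β)` by the recursion (0.20), tree `FlowStepRuns.genSeq`), and
`calLambda φ β (k+1) b = luscherLambda (x̂/2) b`.  The skeleton is not a tree module: below its abbreviations are written UNFOLDED in tree vocabulary
(`flowInvSq φ β n ↦ 1 / FlowStepRuns.genSeq φ (1 / Real.sqrt (2 * β)) n ^ 2`, `calLambda φ β n b ↦ luscherLambda (… / 2) b` — the δ-unfoldings of the
skeleton's `def`s, so every statement here specialises to the skeleton's by `exact`), and the two-loop law is kept ABSTRACT: the theorems hold for every
hypothesis shape `law : ℕ → FlowStep.HBeta → Prop` (read `law M φ := Stmt.twoLoopLawH (stepBal 2 M) (twoLoopStepBal M) φ`) that ADMITS the (kicked) Markov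
calibrators at `M = 2` — which the skeleton's law does: §1 proves its verbatim body for them (`twoLoopLawH_kicked`; `c = 0` is the skeleton's own
`twoLoopLawH_markov`).  Results:

* §1 calibrator kit: the KICKED MARKOV family `φ_{k+1}(g_0,…,g_k) = binf + [k = 0]·c + b1inf·g_k²` obeys the verbatim two-loop law for every kick
  `c ≥ 0` (`c₀ := c`, `θ₀ := 1/2`, `k₀ := 1` — an admissible «wild early step» in the sense of clause (AF-0r)), and a one-step run of (0.20) from a bare
  value with `2β ≤ φ_1(g_0)` leaves the positive axis: `solveCoupling` returns `0` and the calibrator is the JUNK value `x̂ = 1/0² = 0`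
  (`calibrator_one_eq_zero`);
* §2 `labelTracking_false_without_beta1GeOne` — TRACK with the binder `1 ≤ β₁ →` deleted is FALSE for every law satisfiable at `M = 2`: at the STRONG
  root `β₁ < 1` of the matched label (tree `TowerE1.strong_root`) conclusions (i) `1/(4lam³) ≤ x̂` and (ii) `|x̂ − 2β₁| ≤ δ·2β₁` are incompatible
  (no property of `x̂` is used);
* §3 `labelTracking_false_without_windowBetaGeOne` — TRACK with the window's `1 ≤ β` deleted is FALSE for every law admitting at `M = 2` a calibrator
  with first step `≥ 4b₀` (Markov: `stepBal 2 2 = (11/3π²) log 2 > 4b₀`, `four_b0_lt_stepBal_two_two`): at the strong root on the FINE lattice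
  (`β ≤ 2b₀`) the run dies at the first step, `x̂ = 0`, and (i) fails;
* §4 `labelTracking_false_uniformLam1` — TRACK with `∃ lam1` moved BEFORE `∀ φ` is FALSE for every law admitting at `M = 2` calibrators with
  arbitrarily large first step (the kicks `c ≥ 0`): the kick `c := 2β`, chosen after `lam1`, kills the run at the first step.  So `lam1` must depend on
  the calibrator's constants (`c₀`, `γ`, …) — as the registered text allows;
* §5 `cmpTwoLoop_iff_withoutBeta1GeOne` — in CMP-2LOOP the binder `1 ≤ β₁ →` is REMOVABLE (for every law): it follows from the calibrated hypotheses
  (i) and (ii) once `lam ≤ 1/(2(1+δ))` (shrink `lam0`).  Design information for the prover/planner: in rev 3 the two-root pathology of the label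
  (Disproof §B) is confined to TRACK, where `1 ≤ β₁` selects the weak root; CMP-2LOOP never matches labels.
Witness pair everywhere: `(L, b, k) = (M², M, 0)` with `M = 2` (tree `TowerE1.pair_MSq`), `s = 1`, `δ = 1/2`, `lam = min lam1 (1/4)`.  Ordinary negative
lemmas and one equivalence; no verdict on S-BASE, CMP-2LOOP or TRACK themselves (TRACK is plausibly provable: tree `TowerFlow.twoLoopFlow_endpoint`, p542385).
-/

set_option autoImplicit false

noncomputable section

open MeasureTheory Filter Topology Real
open Literature.MathematicalPhysics.QuantumFieldTheory hiding SU2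
open Literature.MathematicalPhysics.QuantumFieldTheory.Balaban1983to89
open scoped BigOperators

namespace Summit.QuantumFields.YangMills.Theorems.TwistedTraceScaling.Negative

open Summit.QuantumFields.YangMills.Theorems.FemtoTransferGap
open Summit.QuantumFields.YangMills.Theorems.FemtoTransferGap.TraceDoor
open Summit.QuantumFields.YangMills.Theorems.FemtoTransferGap.TwoLattice

namespace R3

/-! ## §1 Calibrator kit: the kicked Markov family obeys the two-loop law; the junk one-step run -/

/-- ★ The KICKED MARKOV calibrator `φ_{k+1}(g_0,…,g_k) = binf + [k = 0]·c + b1inf·g_k²` obeys the skeleton's two-loop law `Stmt.twoLoopLawH binf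
b1inf φ` — whose body is the conclusion below, VERBATIM — for every kick `c ≥ 0` (`γ = 1`, `b = binf`, `C₁ = b1inf`, `c₀ = c`, `θ₀ = 1/2`,
`C₃ = c₁ = θ₁ = 0`, `k₀ = 1`); `c = 0` is the skeleton's Markov calibrator (`twoLoopLawH_markov`).
[cite: Balaban1987RG1, (0.20) p.256, Thm 2 p.259] [cite: Balaban1989LargeFieldII, p.355] -/
theorem twoLoopLawH_kicked {binf b1inf c : ℝ} (hbinf : 0 < binf) (hb1 : 0 ≤ b1inf) (hc : 0 ≤ c) (φ : FlowStep.HBeta)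
    (hφ : ∀ (k : ℕ) (p : Fin (k + 1) → ℝ), φ k p = binf + (if k = 0 then c else 0) + b1inf * p (Fin.last k) ^ 2) :
    ∃ S : B12Beta.OneLoopSplit φ, ∃ (γ b C₁ c₀ θ₀ C₃ c₁ θ₁ : ℝ) (k₀ : ℕ),
      0 < γ ∧ 0 < b ∧ 0 ≤ C₁ ∧ 0 ≤ c₀ ∧ 0 ≤ θ₀ ∧ θ₀ < 1 ∧ 0 ≤ C₃ ∧ 0 ≤ c₁ ∧ 0 ≤ θ₁ ∧ θ₁ < 1 ∧
      T4CouplingMatching.EventualLowerH b γ k₀ φ ∧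
      (∀ k : ℕ, |S.β0 k - binf| ≤ c₀ * θ₀ ^ k) ∧
      (∀ (k : ℕ) (p : Fin (k + 1) → ℝ), p ∈ FlowStep.Box γ k → |S.β1 k p| ≤ C₁ * p (Fin.last k)) ∧
      (∀ (K : ℕ) (gs : ℕ → ℝ), FlowStep.RGEqH K φ gs → (∀ k, k ≤ K → 0 < gs k ∧ gs k ≤ γ) →
        ∀ k, k < K → |S.β1 k (FlowStep.prefixOf gs k) - b1inf * gs k ^ 2| ≤ C₃ * gs k ^ 3 + c₁ * θ₁ ^ k) := by
  let S : B12Beta.OneLoopSplit φ :=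
    { β0 := fun k => binf + (if k = 0 then c else 0)
      β1 := fun k p => b1inf * p (Fin.last k) ^ 2
      split := fun k p => hφ k p
      vanish := fun k p hp => by simp [hp] }
  refine ⟨S, 1, binf, b1inf, c, 1 / 2, 0, 0, 0, 1, one_pos, hbinf, hb1, hc, by norm_num, by norm_num, le_rfl, le_rfl,
    le_rfl, one_pos, ?_, ?_, ?_, ?_⟩
  · intro k v hk _
    have hk0 : k ≠ 0 := by omega
    rw [hφ, if_neg hk0]
    nlinarith [mul_nonneg hb1 (sq_nonneg (v (Fin.last k)))]
  · intro k
    show |binf + (if k = 0 then c else 0) - binf| ≤ c * (1 / 2) ^ k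
    rcases Nat.eq_zero_or_pos k with rfl | hk
    · simp [abs_of_nonneg hc]
    · rw [if_neg (by omega)]
      simp only [add_zero, sub_self, abs_zero]
      positivity
  · intro k p hp
    have h := (FlowStep.mem_box.1 hp) (Fin.last k)
    show |b1inf * p (Fin.last k) ^ 2| ≤ b1inf * p (Fin.last k)
    rw [abs_of_nonneg (by positivity)]
    nlinarith [mul_nonneg hb1 h.1.le, h.2]
  · intro K gs _ _ k _
    show |b1inf * (FlowStep.prefixOf gs k) (Fin.last k) ^ 2 - b1inf * gs k ^ 2| ≤ 0 * gs k ^ 3 + 0 * (0 : ℝ) ^ k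
    simp [FlowStep.prefixOf]

/-- ★ JUNK RUN: if the first flow step dominates the bare value, `2β ≤ φ_1(g_0)`, the recursion (0.20) `1/g_1² = 1/g_0² − φ_1(g_0)` leaves the
positive axis, `genSeq φ (1/√(2β)) 1 = solveCoupling (≤ 0) = 0`, and the one-step calibrator is `x̂ = 1/0² = 0`. [cite: Balaban1987RG1, (0.20) p.256] -/
theorem calibrator_one_eq_zero {φ : FlowStep.HBeta} {β : ℝ} (hβ : 0 < β) (h : ∀ p : Fin (0 + 1) → ℝ, 2 * β ≤ φ 0 p) :
    1 / FlowStepRuns.genSeq φ (1 / Real.sqrt (2 * β)) (0 + 1) ^ 2 = 0 := by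
  have hinv : 1 / (1 / Real.sqrt (2 * β)) ^ 2 = 2 * β := by
    rw [div_pow, one_pow, Real.sq_sqrt (by positivity), one_div_one_div]
  have harg : 1 / FlowStepRuns.genSeq φ (1 / Real.sqrt (2 * β)) 0 ^ 2 -
      φ 0 (FlowStep.prefixOf (FlowStepRuns.genSeq φ (1 / Real.sqrt (2 * β))) 0) ≤ 0 := by
    rw [FlowStepRuns.genSeq_zero, hinv]
    linarith [h (FlowStep.prefixOf (FlowStepRuns.genSeq φ (1 / Real.sqrt (2 * β))) 0)]
  rw [FlowStepRuns.genSeq_succ, FlowStepRuns.solveCoupling, if_neg (not_lt.mpr harg)]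
  simp

/-- The SU(2) one-loop step at `M = 2` dominates `4b₀`: `4b₀ = 11/(6π²) < (11/(3π²)) log 2 = stepBal 2 2` (`1/2 < log 2`).  So the Markov calibrator's
first step `stepBal 2 2 + b1inf·g_0²` is `≥ 4b₀`. [cite: Balaban1987RG1, Thm 2 p.259] -/
theorem four_b0_lt_stepBal_two_two : 4 * b0 < B12Normalization.stepBal 2 (2 : ℕ) := by
  have h2 : ((2 : ℕ) : ℝ) = 2 := by norm_num
  rw [h2, B12Normalization.stepBal_two]
  unfold b0
  have hlog : (1 : ℝ) / 2 < Real.log 2 := by linarith [Real.log_two_gt_d9]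
  have e : 4 * (11 / (24 * π ^ 2)) = 11 / (3 * π ^ 2) * (1 / 2) := by field_simp; ring
  rw [e]
  exact mul_lt_mul_of_pos_left hlog (by positivity)

/-- Positivity of the two step constants at `M = 2`: `0 < stepBal 2 2` and `0 ≤ 32·b₁·log 2` (= the skeleton's `twoLoopStepBal 2`). [folklore] -/
theorem steps_two_pos : 0 < B12Normalization.stepBal 2 (2 : ℕ) ∧ 0 ≤ 32 * b1 * Real.log (2 : ℕ) := by
  have hb0 : 0 < b0 := by unfold b0; positivity
  refine ⟨lt_trans (by positivity) four_b0_lt_stepBal_two_two, ?_⟩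
  unfold b1
  have : 0 < Real.log ((2 : ℕ) : ℝ) := Real.log_pos (by norm_num)
  positivity

/-- ANTI-VACUITY of the hypotheses of §2–§5 for the skeleton's law: at `M = 2` the two-loop law (verbatim body) admits, for every `c ≥ 0`, a calibrator
whose first step is `≥ 4b₀` and `≥ c` — the kicked Markov family with `binf = stepBal 2 2`, `b1inf = 32·b₁·log 2`. [folklore] -/
theorem exists_kicked_two (c : ℝ) (hc : 0 ≤ c) :
    ∃ φ : FlowStep.HBeta,
      (∃ S : B12Beta.OneLoopSplit φ, ∃ (γ b C₁ c₀ θ₀ C₃ c₁ θ₁ : ℝ) (k₀ : ℕ),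
        0 < γ ∧ 0 < b ∧ 0 ≤ C₁ ∧ 0 ≤ c₀ ∧ 0 ≤ θ₀ ∧ θ₀ < 1 ∧ 0 ≤ C₃ ∧ 0 ≤ c₁ ∧ 0 ≤ θ₁ ∧ θ₁ < 1 ∧
        T4CouplingMatching.EventualLowerH b γ k₀ φ ∧
        (∀ k : ℕ, |S.β0 k - B12Normalization.stepBal 2 (2 : ℕ)| ≤ c₀ * θ₀ ^ k) ∧
        (∀ (k : ℕ) (p : Fin (k + 1) → ℝ), p ∈ FlowStep.Box γ k → |S.β1 k p| ≤ C₁ * p (Fin.last k)) ∧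
        (∀ (K : ℕ) (gs : ℕ → ℝ), FlowStep.RGEqH K φ gs → (∀ k, k ≤ K → 0 < gs k ∧ gs k ≤ γ) →
          ∀ k, k < K → |S.β1 k (FlowStep.prefixOf gs k) - 32 * b1 * Real.log (2 : ℕ) * gs k ^ 2| ≤ C₃ * gs k ^ 3 + c₁ * θ₁ ^ k)) ∧
      (∀ p : Fin (0 + 1) → ℝ, 4 * b0 ≤ φ 0 p) ∧ (∀ p : Fin (0 + 1) → ℝ, c ≤ φ 0 p) := by
  obtain ⟨hbinf, hb1inf⟩ := steps_two_pos
  refine ⟨fun k p => B12Normalization.stepBal 2 (2 : ℕ) + (if k = 0 then c else 0) + 32 * b1 * Real.log (2 : ℕ) * p (Fin.last k) ^ 2,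
    twoLoopLawH_kicked hbinf hb1inf hc _ (fun k p => rfl), fun p => ?_, fun p => ?_⟩
  · show 4 * b0 ≤ B12Normalization.stepBal 2 (2 : ℕ) + (if (0 : ℕ) = 0 then c else 0) + 32 * b1 * Real.log (2 : ℕ) * p (Fin.last 0) ^ 2
    rw [if_pos rfl]
    nlinarith [four_b0_lt_stepBal_two_two, mul_nonneg hb1inf (sq_nonneg (p (Fin.last 0)))]
  · show c ≤ B12Normalization.stepBal 2 (2 : ℕ) + (if (0 : ℕ) = 0 then c else 0) + 32 * b1 * Real.log (2 : ℕ) * p (Fin.last 0) ^ 2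
    rw [if_pos rfl]
    nlinarith [mul_nonneg hb1inf (sq_nonneg (p (Fin.last 0)))]

/-- Depth bookkeeping: `0 < lam ≤ 1/4` gives `16 ≤ 1/(4lam³)`. [folklore] -/
theorem sixteen_le_of_quarter {lam : ℝ} (h0 : 0 < lam) (h4 : lam ≤ 1 / 4) : 16 ≤ 1 / (4 * lam ^ 3) := by
  rw [le_div_iff₀ (by positivity)]
  have h3 : lam ^ 3 ≤ (1 / 4) ^ 3 := pow_le_pow_left₀ h0.le h4 3
  nlinarith

/-! ## §2 TRACK: the base guard `1 ≤ β₁` is load-bearing -/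

/-- **TRACK without `1 ≤ β₁` is false**, for EVERY hypothesis shape `law` satisfiable at `M = 2` (the skeleton's `Stmt.twoLoopLawH (stepBal 2 M)
(twoLoopStepBal M)` is: `exists_kicked_two`).  The negated text is `Stmt.stub_labelTracking` with the binder `1 ≤ β₁ →` deleted, its abbreviations
unfolded.  Witness: `M = 2`, `δ = 1/2`, `s = 1`, `(L,b,k) = (4,2,0)`, `β ≥ 1` the weak root on `4` and `β₁ < 1` the STRONG root on `2` of the label
value `1/lam³`, `lam = min lam1 (1/4)`: conclusion (ii) gives `x̂ ≤ 3β₁ < 3`, conclusion (i) gives `x̂ ≥ 16`. [folklore] -/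
theorem labelTracking_false_without_beta1GeOne (law : ℕ → FlowStep.HBeta → Prop) (hlaw : ∃ φ : FlowStep.HBeta, law 2 φ) :
    ¬ (∀ M : ℕ, 2 ≤ M → ∀ δ : ℝ, 0 < δ → ∀ s : ℝ, 0 < s →
        ∀ φ : FlowStep.HBeta, law M φ →
          ∃ lam1 : ℝ, 0 < lam1 ∧ ∀ lam : ℝ, 0 < lam → lam ≤ lam1 →
            ∀ (L : ℕ) [NeZero L], M ^ 2 ≤ L → ∀ β : ℝ, InFemtoWindow lam β L →
              ∀ (b k : ℕ) [NeZero b], M ≤ b → b < M ^ 2 → b * M ^ (k + 1) ≤ L → L < b * M ^ k * (M + 1) →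
                ∀ β₁ : ℝ, invRunningCoupling β₁ b = invRunningCoupling β L →
                  1 / (4 * lam ^ 3) ≤ 1 / FlowStepRuns.genSeq φ (1 / Real.sqrt (2 * β)) (k + 1) ^ 2 ∧
                  |1 / FlowStepRuns.genSeq φ (1 / Real.sqrt (2 * β)) (k + 1) ^ 2 - 2 * β₁| ≤ δ * (2 * β₁) ∧
                  |(femtoSteps s β L : ℝ) * luscherLambda (1 / FlowStepRuns.genSeq φ (1 / Real.sqrt (2 * β)) (k + 1) ^ 2 / 2) b / L - s| ≤ δ) := by
  intro h
  obtain ⟨φ, hφ⟩ := hlaw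
  obtain ⟨lam1, hlam1, H⟩ := h 2 le_rfl (1 / 2) (by norm_num) 1 one_pos φ hφ
  obtain ⟨lam, hlam, hle1, hle4⟩ : ∃ lam : ℝ, 0 < lam ∧ lam ≤ lam1 ∧ lam ≤ 1 / 4 :=
    ⟨min lam1 (1 / 4), lt_min hlam1 (by norm_num), min_le_left _ _, min_le_right _ _⟩
  have hone : lam ≤ 1 := by linarith
  haveI : NeZero ((2 : ℕ) ^ 2) := ⟨by norm_num⟩
  obtain ⟨β, hβ1, hval, hΛ, hW⟩ := TowerE1.weak_root (2 ^ 2) hlam hone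
  obtain ⟨β₁, hβ₁0, hβ₁1, -, hval₁, -⟩ := TowerE1.strong_root 2 hlam hone
  have hmatch : invRunningCoupling β₁ 2 = invRunningCoupling β (2 ^ 2) := by rw [hval₁, hval]
  obtain ⟨c1, c2, c3, c4⟩ := TowerE1.pair_MSq 2 le_rfl
  obtain ⟨hi, hii, -⟩ := H lam hlam hle1 (2 ^ 2) le_rfl β hW 2 0 c1 c2 c3 c4 β₁ hmatch
  have h16 := sixteen_le_of_quarter hlam hle4
  have h2 := (abs_le.mp hii).2
  linarith

/-! ## §3 TRACK: the window guard `1 ≤ β` (fine lattice) is load-bearing -/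

/-- **TRACK without the window's `1 ≤ β` is false**, for EVERY `law` admitting at `M = 2` a calibrator whose first step is `≥ 4b₀` (the skeleton's
is: `exists_kicked_two`).  The negated text is `Stmt.stub_labelTracking` with `InFemtoWindow lam β L` weakened to its two `Λ`-inequalities, abbreviations
unfolded.  Witness: `M = 2`, `δ = 1/2`, `s = 1`, `(L,b,k) = (4,2,0)`, `β` the STRONG root on `4` (`β ≤ 2b₀`, so `2β ≤ 4b₀ ≤ φ_1`) and `β₁ ≥ 1` the
weak root on `2`: the run dies at the first step (`x̂ = 0`, `calibrator_one_eq_zero`), contradicting conclusion (i) `1/(4lam³) ≤ x̂`. [folklore] -/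
theorem labelTracking_false_without_windowBetaGeOne (law : ℕ → FlowStep.HBeta → Prop) (φ₀ : FlowStep.HBeta) (hlaw : law 2 φ₀)
    (hφ₀ : ∀ p : Fin (0 + 1) → ℝ, 4 * b0 ≤ φ₀ 0 p) :
    ¬ (∀ M : ℕ, 2 ≤ M → ∀ δ : ℝ, 0 < δ → ∀ s : ℝ, 0 < s →
        ∀ φ : FlowStep.HBeta, law M φ →
          ∃ lam1 : ℝ, 0 < lam1 ∧ ∀ lam : ℝ, 0 < lam → lam ≤ lam1 →
            ∀ (L : ℕ) [NeZero L], M ^ 2 ≤ L → ∀ β : ℝ, lam ≤ luscherLambda β L → luscherLambda β L ≤ 2 * lam →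
              ∀ (b k : ℕ) [NeZero b], M ≤ b → b < M ^ 2 → b * M ^ (k + 1) ≤ L → L < b * M ^ k * (M + 1) →
                ∀ β₁ : ℝ, 1 ≤ β₁ → invRunningCoupling β₁ b = invRunningCoupling β L →
                  1 / (4 * lam ^ 3) ≤ 1 / FlowStepRuns.genSeq φ (1 / Real.sqrt (2 * β)) (k + 1) ^ 2 ∧
                  |1 / FlowStepRuns.genSeq φ (1 / Real.sqrt (2 * β)) (k + 1) ^ 2 - 2 * β₁| ≤ δ * (2 * β₁) ∧
                  |(femtoSteps s β L : ℝ) * luscherLambda (1 / FlowStepRuns.genSeq φ (1 / Real.sqrt (2 * β)) (k + 1) ^ 2 / 2) b / L - s| ≤ δ) := by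
  intro h
  obtain ⟨lam1, hlam1, H⟩ := h 2 le_rfl (1 / 2) (by norm_num) 1 one_pos φ₀ hlaw
  obtain ⟨lam, hlam, hle1, hle4⟩ : ∃ lam : ℝ, 0 < lam ∧ lam ≤ lam1 ∧ lam ≤ 1 / 4 :=
    ⟨min lam1 (1 / 4), lt_min hlam1 (by norm_num), min_le_left _ _, min_le_right _ _⟩
  have hone : lam ≤ 1 := by linarith
  haveI : NeZero ((2 : ℕ) ^ 2) := ⟨by norm_num⟩
  obtain ⟨β, hβ0, -, hβle, hval, hΛ⟩ := TowerE1.strong_root (2 ^ 2) hlam hone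
  obtain ⟨β₁, hβ₁1, hval₁, -, -⟩ := TowerE1.weak_root 2 hlam hone
  have hmatch : invRunningCoupling β₁ 2 = invRunningCoupling β (2 ^ 2) := by rw [hval₁, hval]
  obtain ⟨c1, c2, c3, c4⟩ := TowerE1.pair_MSq 2 le_rfl
  obtain ⟨hi, -, -⟩ := H lam hlam hle1 (2 ^ 2) le_rfl β (by rw [hΛ]) (by rw [hΛ]; linarith) 2 0 c1 c2 c3 c4 β₁ hβ₁1 hmatch
  -- the strong root is below `2b₀`, so `2β ≤ 4b₀ ≤ φ₀ 0 _`
  have hb0 : 0 < b0 := by unfold b0; positivity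
  have hexp : Real.exp (-(b0 / b1) * (1 / lam ^ 3 - 1 / 2)) ≤ 1 := by
    rw [Real.exp_le_one_iff]
    have hb1 : 0 < b1 := by unfold b1; positivity
    have h1 : (1 : ℝ) ≤ 1 / lam ^ 3 := by
      rw [le_div_iff₀ (by positivity)]; nlinarith [pow_le_one₀ (n := 3) hlam.le hone]
    have : 0 ≤ b0 / b1 * (1 / lam ^ 3 - 1 / 2) := by
      apply mul_nonneg (div_pos hb0 hb1).le; linarith
    linarith
  have hβ2 : ∀ p : Fin (0 + 1) → ℝ, 2 * β ≤ φ₀ 0 p := by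
    intro p
    have : β ≤ 2 * b0 := by
      calc β ≤ 2 * b0 * Real.exp (-(b0 / b1) * (1 / lam ^ 3 - 1 / 2)) := hβle
        _ ≤ 2 * b0 * 1 := mul_le_mul_of_nonneg_left hexp (by positivity)
        _ = 2 * b0 := mul_one _
    linarith [hφ₀ p]
  rw [calibrator_one_eq_zero hβ0 hβ2] at hi
  have : 0 < 1 / (4 * lam ^ 3) := by positivity
  linarith

/-! ## §4 TRACK: the depth `lam1` must depend on the calibrator (`∀ φ ∃ lam1`, not `∃ lam1 ∀ φ`) -/

/-- **TRACK with `∃ lam1` in front of `∀ φ` is false**, for EVERY `law` admitting at `M = 2` calibrators with arbitrarily large first step (the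
skeleton's does, with the kicks `c ≥ 0`: `exists_kicked_two`).  Given the uniform `lam1`, take `lam = min lam1 (1/4)`, the weak roots `β` on `4` and
`β₁` on `2`, and THEN a calibrator with first step `≥ 2β`: its run from `2β` dies at the first step, `x̂ = 0`, contradicting (i).  Moral: `lam1` is a
function of the calibrator's constants (here of `c₀` in (AF-0r)), exactly as the registered text allows. [folklore] -/
theorem labelTracking_false_uniformLam1 (law : ℕ → FlowStep.HBeta → Prop)
    (hlaw : ∀ c : ℝ, 0 ≤ c → ∃ φ : FlowStep.HBeta, law 2 φ ∧ ∀ p : Fin (0 + 1) → ℝ, c ≤ φ 0 p) :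
    ¬ (∀ M : ℕ, 2 ≤ M → ∀ δ : ℝ, 0 < δ → ∀ s : ℝ, 0 < s →
        ∃ lam1 : ℝ, 0 < lam1 ∧
          ∀ φ : FlowStep.HBeta, law M φ →
            ∀ lam : ℝ, 0 < lam → lam ≤ lam1 →
            ∀ (L : ℕ) [NeZero L], M ^ 2 ≤ L → ∀ β : ℝ, InFemtoWindow lam β L →
              ∀ (b k : ℕ) [NeZero b], M ≤ b → b < M ^ 2 → b * M ^ (k + 1) ≤ L → L < b * M ^ k * (M + 1) →
                ∀ β₁ : ℝ, 1 ≤ β₁ → invRunningCoupling β₁ b = invRunningCoupling β L →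
                  1 / (4 * lam ^ 3) ≤ 1 / FlowStepRuns.genSeq φ (1 / Real.sqrt (2 * β)) (k + 1) ^ 2 ∧
                  |1 / FlowStepRuns.genSeq φ (1 / Real.sqrt (2 * β)) (k + 1) ^ 2 - 2 * β₁| ≤ δ * (2 * β₁) ∧
                  |(femtoSteps s β L : ℝ) * luscherLambda (1 / FlowStepRuns.genSeq φ (1 / Real.sqrt (2 * β)) (k + 1) ^ 2 / 2) b / L - s| ≤ δ) := by
  intro h
  obtain ⟨lam1, hlam1, H⟩ := h 2 le_rfl (1 / 2) (by norm_num) 1 one_pos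
  obtain ⟨lam, hlam, hle1, hle4⟩ : ∃ lam : ℝ, 0 < lam ∧ lam ≤ lam1 ∧ lam ≤ 1 / 4 :=
    ⟨min lam1 (1 / 4), lt_min hlam1 (by norm_num), min_le_left _ _, min_le_right _ _⟩
  have hone : lam ≤ 1 := by linarith
  haveI : NeZero ((2 : ℕ) ^ 2) := ⟨by norm_num⟩
  obtain ⟨β, hβ1, hval, -, hW⟩ := TowerE1.weak_root (2 ^ 2) hlam hone
  obtain ⟨β₁, hβ₁1, hval₁, -, -⟩ := TowerE1.weak_root 2 hlam hone
  have hmatch : invRunningCoupling β₁ 2 = invRunningCoupling β (2 ^ 2) := by rw [hval₁, hval]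
  obtain ⟨c1, c2, c3, c4⟩ := TowerE1.pair_MSq 2 le_rfl
  have hβ0 : 0 < β := by linarith
  obtain ⟨φ, hφ, hφ0⟩ := hlaw (2 * β) (by linarith)
  obtain ⟨hi, -, -⟩ := H φ hφ lam hlam hle1 (2 ^ 2) le_rfl β hW 2 0 c1 c2 c3 c4 β₁ hβ₁1 hmatch
  rw [calibrator_one_eq_zero hβ0 hφ0] at hi
  have : 0 < 1 / (4 * lam ^ 3) := by positivity
  linarith

/-! ## §5 CMP-2LOOP: the base guard `1 ≤ β₁` is removable (it follows from the calibrated hypotheses) -/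

/-- Calibrated hypotheses force the weak branch: `1/(4lam³) ≤ x̂`, `|x̂ − 2β₁| ≤ δ·2β₁` and `lam ≤ 1/(2(1+δ))` give `1 ≤ β₁`. [folklore] -/
theorem one_le_beta1_of_calibrated {lam δ x β₁ : ℝ} (hlam : 0 < lam) (hδ : 0 < δ) (hle : lam ≤ 1 / (2 * (1 + δ)))
    (hx : 1 / (4 * lam ^ 3) ≤ x) (hmis : |x - 2 * β₁| ≤ δ * (2 * β₁)) : 1 ≤ β₁ := by
  by_contra hlt
  rw [not_le] at hlt
  have h2 : x ≤ (1 + δ) * (2 * β₁) := by linarith [(abs_le.mp hmis).2]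
  have h3 : (1 + δ) * (2 * β₁) < 2 * (1 + δ) := by nlinarith
  have hprod : lam * (2 * (1 + δ)) ≤ 1 := by rwa [le_div_iff₀ (by positivity)] at hle
  have hhalf : lam ≤ 1 / 2 := by
    rw [le_div_iff₀ (by norm_num : (0 : ℝ) < 2)]; nlinarith
  have h4 : 2 * (1 + δ) ≤ 1 / (4 * lam ^ 3) := by
    rw [le_div_iff₀ (by positivity)]
    have hl2 : lam ^ 2 ≤ 1 / 4 := by nlinarith
    have : 4 * lam ^ 3 ≤ lam := by nlinarith
    nlinarith
  linarith

/-- ★ **In CMP-2LOOP the binder `1 ≤ β₁ →` is removable**: for every `law`, the text of `Stmt.stub_cmpTwoLoop` (abbreviations unfolded) and the same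
text with the binder deleted are EQUIVALENT (`→`: shrink `lam0` to `min lam0 (1/(2(1+δ)))` and use `one_le_beta1_of_calibrated`; `←`: weakening).
Design information: in rev 3 the two-root pathology of the label is confined to TRACK. [folklore] -/
theorem cmpTwoLoop_iff_withoutBeta1GeOne (law : ℕ → FlowStep.HBeta → Prop) :
    (∀ s : ℝ, 0 < s → ∀ ε : ℝ, 0 < ε → ∃ M : ℕ, 2 ≤ M ∧ ∃ δ : ℝ, 0 < δ ∧
      ∀ φ : FlowStep.HBeta, law M φ →
        ∃ lam0 : ℝ, 0 < lam0 ∧ ∀ lam : ℝ, 0 < lam → lam ≤ lam0 →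
          ∀ (L : ℕ) [NeZero L], M ^ 2 ≤ L → ∀ β : ℝ, InFemtoWindow lam β L →
            ∀ (b k : ℕ) [NeZero b], M ≤ b → b < M ^ 2 → b * M ^ (k + 1) ≤ L → L < b * M ^ k * (M + 1) →
              1 / (4 * lam ^ 3) ≤ 1 / FlowStepRuns.genSeq φ (1 / Real.sqrt (2 * β)) (k + 1) ^ 2 →
              ∀ β₁ : ℝ, 1 ≤ β₁ → |1 / FlowStepRuns.genSeq φ (1 / Real.sqrt (2 * β)) (k + 1) ^ 2 - 2 * β₁| ≤ δ * (2 * β₁) →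
                ∀ T : ℕ, |(T : ℝ) * luscherLambda (1 / FlowStepRuns.genSeq φ (1 / Real.sqrt (2 * β)) (k + 1) ^ 2 / 2) b / L - s| ≤ δ →
                  |traceRatio L β T - traceRatio b β₁ (femtoSteps s β₁ b)| ≤ ε) ↔
    (∀ s : ℝ, 0 < s → ∀ ε : ℝ, 0 < ε → ∃ M : ℕ, 2 ≤ M ∧ ∃ δ : ℝ, 0 < δ ∧
      ∀ φ : FlowStep.HBeta, law M φ →
        ∃ lam0 : ℝ, 0 < lam0 ∧ ∀ lam : ℝ, 0 < lam → lam ≤ lam0 →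
          ∀ (L : ℕ) [NeZero L], M ^ 2 ≤ L → ∀ β : ℝ, InFemtoWindow lam β L →
            ∀ (b k : ℕ) [NeZero b], M ≤ b → b < M ^ 2 → b * M ^ (k + 1) ≤ L → L < b * M ^ k * (M + 1) →
              1 / (4 * lam ^ 3) ≤ 1 / FlowStepRuns.genSeq φ (1 / Real.sqrt (2 * β)) (k + 1) ^ 2 →
              ∀ β₁ : ℝ, |1 / FlowStepRuns.genSeq φ (1 / Real.sqrt (2 * β)) (k + 1) ^ 2 - 2 * β₁| ≤ δ * (2 * β₁) →
                ∀ T : ℕ, |(T : ℝ) * luscherLambda (1 / FlowStepRuns.genSeq φ (1 / Real.sqrt (2 * β)) (k + 1) ^ 2 / 2) b / L - s| ≤ δ →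
                  |traceRatio L β T - traceRatio b β₁ (femtoSteps s β₁ b)| ≤ ε) := by
  constructor
  · intro h s hs ε hε
    obtain ⟨M, hM, δ, hδ, H⟩ := h s hs ε hε
    refine ⟨M, hM, δ, hδ, fun φ hφ => ?_⟩
    obtain ⟨lam0, hlam0, H1⟩ := H φ hφ
    refine ⟨min lam0 (1 / (2 * (1 + δ))), lt_min hlam0 (by positivity), ?_⟩
    intro lam hlam hle L _ hL β hW b k _ hMb hbM hkL hLk hx β₁ hmis T hT
    have hβ₁ : 1 ≤ β₁ := one_le_beta1_of_calibrated hlam hδ (hle.trans (min_le_right _ _)) hx hmis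
    exact H1 lam hlam (hle.trans (min_le_left _ _)) L hL β hW b k hMb hbM hkL hLk hx β₁ hβ₁ hmis T hT
  · intro h s hs ε hε
    obtain ⟨M, hM, δ, hδ, H⟩ := h s hs ε hε
    refine ⟨M, hM, δ, hδ, fun φ hφ => ?_⟩
    obtain ⟨lam0, hlam0, H1⟩ := H φ hφ
    refine ⟨lam0, hlam0, ?_⟩
    intro lam hlam hle L _ hL β hW b k _ hMb hbM hkL hLk hx β₁ _ hmis T hT
    exact H1 lam hlam hle L hL β hW b k hMb hbM hkL hLk hx β₁ hmis T hT

end R3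

end Summit.QuantumFields.YangMills.Theorems.TwistedTraceScaling.Negative

end
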